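import Mathlib
import Literature.Analysis.FluidPDE.LeiZhang2017AxisymmetricCriteria
import Literature.Analysis.FluidPDE.LeiZhang2017AxisymmetricCriteriaProofs
import Literature.Analysis.FluidPDE.LeiZhang2017SmallSwirlProof
import Literature.Analysis.FluidPDE.Seregin2022LogSwirlCriterion
import Literature.Analysis.FluidPDE.Seregin2020AxisymmetricTypeII
import Literature.Analysis.FluidPDE.SereginSverakPressureDecayBalls
import HarnessLib.Audit
import HarnessLib

/-!
# SwirlThresholdLadderLocal — axisymmetric threshold functions, LOCAL ladders (ROUND-13, nsreg-p2)

Two printed families of regularity criteria for axisymmetric Navier–Stokes flows carry an explicit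
THRESHOLD FUNCTION; this file types both families as one-parameter ladders, puts the printed rungs
on them BY NAME, proves the order relations between rungs, and types the endpoints, which are the
two questions Lei–Ren leave open in print (Adv. Math. 457 (2024) 109654 = arXiv:2210.01783, p. 6):

This is the second half (sections B, B′, C) of the ROUND-13 companion; the GLOBAL axis-modulus and
datum-gauge ladders (`SwirlModulusCriterion`, `AxisSwirlThreshold`, `RelDatumSwirlThreshold`,
`LogDatumSwirlThreshold`) are `…Theorems.SwirlThresholdLadder` (independent of this file).

* the **local small-swirl threshold ladder** (local suitable weak frame of the tree fact
  `seregin2022_logSwirl_regularAtOrigin`): `LocalSwirlThreshold φ` = "an axisymmetric suitable weak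
  solution in the unit parabolic cylinder with `|Γ| ≤ φ(G,H)` on `Q(1)` is regular at the origin",
  `G = ∫_{Q(1)} |v|³ + |q|^{3/2}`, `H = ∫_{Q(1)} |∇v|²`.  Printed rung (Lei–Ren 2024 Thm. 3):
  `φ(G,H) = M₄⁻¹ [(min{H,G}+1) ln(G+2)]^{-3/2}` (`LeiRen2024LocalSmallSwirl`, a typing request, not
  yet a Literature fact); the coarse monotone ladder `RelLocalSwirlThreshold κ := ∃ c > 0,
  LocalSwirlThreshold (fun G H ↦ c (2+G+H)^{-κ})`; kernel: `relLocal_three_of_leiRen` (print ⇒ κ = 3),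
  `RelLocalSwirlThreshold.mono` (κ ≤ κ' ⇒ rung κ ⇒ rung κ'), and the ENDPOINT
  `AbsoluteLocalSmallSwirl := ∃ c > 0, LocalSwirlThreshold (fun _ _ ↦ c)` = `RelLocalSwirlThreshold 0`
  (`absolute_iff_relLocal_zero`) — Lei–Ren p. 6: "It is desirable to replace the condition by an
  absolute smallness assumption ‖Γ‖_{L^∞(Q(1))} ≤ c … beyond the reach of existing methods".

* the **local axis-modulus ladder** `LocalSwirlModulusCriterion m` (frame of the tree fact
  `seregin2022_logSwirl_regularAtOrigin`, which IS the family of rungs `m = C₁/ln³(e/r)`: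
  `seregin_iff`); the rung `m = |ln r|^{-3/2}` (`LocalWeiModulus`, a LOCAL Wei criterion) is not in
  print and is the rung that would halve the a-priori modulus required by the registered line of
  crux `AxisymmetricKatoGlobal` (stmt-…-15453, `stub_swirlAxisModulus`).
* the **Type-II-excess ladder** `DissipationGrowthCriterion ω` (frame of the tree fact
  `Seregin2020_axisymmetricSingularPoint_typeII`; one-point growth bound `E(r) ≤ K ω(r)` on the
  scaled dissipation `cknE` ⇒ no backward singularity at the origin): `ω ≡ 1` follows from Seregin
  2020's fact (`dissipationGrowth_const_of_seregin2020`); `ω = (ln|ln r|)^μ` is Lei–Ren Thm. 4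
  (`LeiRen2024ImprovedCKN`, typing request); `ω = |ln r|^μ` is Lei–Ren's second QUESTION
  (`LogExcessCriterion μ`); `ω = r^{-κ}` (`PowerExcessCriterion κ`) excludes Type II of excess order
  `κ`, and `κ = 1` is no hypothesis: `powerOne_iff_localAxisymRegularity`.  Order lemmas:
  `logExcess_of_powerExcess`, `loglog_of_logExcess`, `const_of_loglog`, `excessLadder_summary`.

Nothing here is a regularity theorem (`dissipationGrowth_const_of_seregin2020` re-derives a PRINT rung from the tree fact
taken as hypothesis): the open nodes are `def`s tagged `@[conjecture]`, the printed
rungs enter as hypotheses or through the tree's named facts, and every `theorem` is order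
bookkeeping between typed statements.
-/

namespace Summit.NavierStokesRegularity.NavierStokesRegularity.Theorems.SwirlThresholdLadderLocal

open MeasureTheory Set Filter Topology
open scoped ENNReal NNReal
open Literature.Analysis.FluidPDE

local notation "ℝ³" => EuclideanSpace ℝ (Fin 3)

noncomputable section

/-! ## B. The local small-swirl threshold ladder (local suitable weak frame, `ν = 1`) -/

/-- `LocalSwirlThreshold φ`: in the frame of the tree fact `seregin2022_logSwirl_regularAtOrigin`
(a suitable weak solution `(v,q)` of Navier–Stokes, `ν = 1`, in the unit parabolic cylinder
`Q = 𝒞 × ]-1,0[` with the global classes `v ∈ L_{2,∞}(Q)`, `∇v ∈ L₂(Q)`, `q ∈ L_{3/2}(Q)`,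
axisymmetric slices), writing `G = ∫_Q (|v|³ + |q|^{3/2})` and `H = ∫_Q |∇v|²` (Lei–Ren's local
energies, arXiv:2210.01783 p. 4), the swirl bound `|Γ(t,x)| ≤ φ(G,H)` on `Q` (off the axis) forces
the origin to be a regular point. -/
def LocalSwirlThreshold (φ : ℝ → ℝ → ℝ) : Prop :=
  ∀ (v : ℝ → ℝ³ → ℝ³) (q : ℝ → ℝ³ → ℝ),
    IsSuitableWeakSolutionOn (SereginSverak2009.parCylOpens 0 1) 1 0 v q →
    (∃ C : ℝ≥0, ∀ᵐ t ∂(volume.restrict (Ioo (-1 : ℝ) 0)),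
        ∫⁻ x in SereginSverak2009.spaceCyl 0 1, ‖v t x‖ₑ ^ 2 ≤ C) →
    ∀ (Gr : ℝ → ℝ³ → ℝ³ →L[ℝ] ℝ³),
      HasWeakSpatialGradientOn (SereginSverak2009.parCylOpens 0 1) v Gr →
      ∀ (G H : ℝ),
        (∫⁻ z in SereginSverak2009.parCyl 0 1,
            (‖v z.1 z.2‖ₑ ^ (3 : ℝ) + ‖q z.1 z.2‖ₑ ^ (3 / 2 : ℝ))) = ENNReal.ofReal G →
        (∫⁻ z in SereginSverak2009.parCyl 0 1,
            ENNReal.ofReal (frobeniusNormSq (Gr z.1 z.2))) = ENNReal.ofReal H →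
        0 ≤ G → 0 ≤ H →
        (∀ t ∈ Ioo (-1 : ℝ) 0, IsAxisymmetric (v t)) →
        (∀ t ∈ Ioo (-1 : ℝ) 0, IsAxisymmetricScalar (q t)) →
        (∀ t ∈ Ioo (-1 : ℝ) 0, ∀ x ∈ SereginSverak2009.spaceCyl 0 1, 0 < cylRadius x →
            |swirl (v t) x| ≤ φ G H) →
        SereginSverak2009.IsRegularAtOrigin v

/-- Lei–Ren's printed threshold function (Adv. Math. 2024, Thm. 3):
`φ(G,H) = M₄⁻¹ [(min{H,G} + 1) ln(G + 2)]^{-3/2}`. -/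
def leiRenThreshold (M₄ : ℝ) (G H : ℝ) : ℝ :=
  M₄⁻¹ * ((min H G + 1) * Real.log (G + 2)) ^ (-(3 / 2 : ℝ))

/-- **Lei–Ren 2024, Thm. 3 (local small-swirl regularity), in this frame** — a TYPING REQUEST
(printed theorem, arXiv:2210.01783 p. 6; conclusion weakened from "regular in the closure of
`Q(1/2)`" to regularity at the origin); used below only as a hypothesis. -/
def LeiRen2024LocalSmallSwirl : Prop := ∃ M₄ : ℝ, 0 < M₄ ∧ LocalSwirlThreshold (leiRenThreshold M₄)

/-- The coarse relative ladder: threshold `c (2 + G + H)^{-κ}` (base `≥ 2`, so monotone in `κ`). -/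
@[conjecture] def RelLocalSwirlThreshold (κ : ℝ) : Prop :=
  ∃ c : ℝ, 0 < c ∧ LocalSwirlThreshold (fun G H => c * (2 + G + H) ^ (-κ))

/-- **The endpoint (Lei–Ren's open question, p. 6): ABSOLUTE local small-swirl regularity.** -/
@[conjecture] def AbsoluteLocalSmallSwirl : Prop :=
  ∃ c : ℝ, 0 < c ∧ LocalSwirlThreshold (fun _ _ => c)

/-- Monotonicity of the local family in the threshold function. -/
theorem LocalSwirlThreshold.mono {φ₁ φ₂ : ℝ → ℝ → ℝ} (h : LocalSwirlThreshold φ₂)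
    (hle : ∀ G H : ℝ, 0 ≤ G → 0 ≤ H → φ₁ G H ≤ φ₂ G H) : LocalSwirlThreshold φ₁ := by
  intro v q hsw hL2 Gr hGr G H hG hH hG0 hH0 hax haxq hΓ
  exact h v q hsw hL2 Gr hGr G H hG hH hG0 hH0 hax haxq
    (fun t ht x hx hr => (hΓ t ht x hx hr).trans (hle G H hG0 hH0))

/-- `κ = 0` is the absolute threshold. -/
theorem absolute_iff_relLocal_zero : AbsoluteLocalSmallSwirl ↔ RelLocalSwirlThreshold 0 := by
  unfold AbsoluteLocalSmallSwirl RelLocalSwirlThreshold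
  have : ∀ c : ℝ, (fun G H : ℝ => c * (2 + G + H) ^ (-(0 : ℝ))) = fun _ _ => c := by
    intro c; funext G H; simp
  simp_rw [this]

/-- The ladder is monotone: a smaller exponent is a stronger theorem. -/
theorem RelLocalSwirlThreshold.mono {κ κ' : ℝ} (h : RelLocalSwirlThreshold κ) (hle : κ ≤ κ') :
    RelLocalSwirlThreshold κ' := by
  obtain ⟨c, hc, h⟩ := h
  refine ⟨c, hc, h.mono fun G H hG hH => ?_⟩
  have hb : 1 ≤ 2 + G + H := by linarith
  exact mul_le_mul_of_nonneg_left
    (Real.rpow_le_rpow_of_exponent_le hb (neg_le_neg hle)) hc.le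

/-- The absolute threshold implies every relative rung. -/
theorem relLocal_of_absolute (h : AbsoluteLocalSmallSwirl) {κ : ℝ} (hκ : 0 ≤ κ) :
    RelLocalSwirlThreshold κ :=
  (absolute_iff_relLocal_zero.1 h).mono hκ

/-- Elementary comparison: Lei–Ren's threshold dominates `M₄⁻¹ (2+G+H)^{-3}`. -/
theorem leiRenThreshold_ge {M₄ G H : ℝ} (hM : 0 < M₄) (hG : 0 ≤ G) (hH : 0 ≤ H) :
    M₄⁻¹ * (2 + G + H) ^ (-(3 : ℝ)) ≤ leiRenThreshold M₄ G H := by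
  unfold leiRenThreshold
  refine mul_le_mul_of_nonneg_left ?_ (inv_pos.2 hM).le
  have hlog : Real.log (G + 2) ≤ 2 + G + H := by
    have h1 : Real.log (G + 2) ≤ (G + 2) - 1 := Real.log_le_sub_one_of_pos (by linarith)
    linarith
  have hlogpos : 0 < Real.log (G + 2) := Real.log_pos (by linarith)
  have hmin : min H G + 1 ≤ 2 + G + H := by
    have := min_le_right H G; linarith
  have hminpos : 0 < min H G + 1 := by
    have : 0 ≤ min H G := le_min hH hG; linarith
  have hprod : (min H G + 1) * Real.log (G + 2) ≤ (2 + G + H) ^ (2 : ℝ) := by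
    rw [Real.rpow_two, sq]
    exact mul_le_mul hmin hlog hlogpos.le (by linarith)
  have hprodpos : 0 < (min H G + 1) * Real.log (G + 2) := mul_pos hminpos hlogpos
  have hb : 0 < 2 + G + H := by linarith
  calc (2 + G + H) ^ (-(3 : ℝ)) = ((2 + G + H) ^ (2 : ℝ)) ^ (-(3 / 2 : ℝ)) := by
          rw [← Real.rpow_mul hb.le]; norm_num
    _ ≤ ((min H G + 1) * Real.log (G + 2)) ^ (-(3 / 2 : ℝ)) :=
          Real.rpow_le_rpow_of_nonpos hprodpos hprod (by norm_num)

/-- **Print ⇒ the rung `κ = 3`** of the coarse ladder (Lei–Ren's own normalisation is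
`κ = 3/2` up to a logarithm; the coarse base `2+G+H` costs the factor 2). -/
theorem relLocal_three_of_leiRen (h : LeiRen2024LocalSmallSwirl) : RelLocalSwirlThreshold 3 := by
  obtain ⟨M₄, hM, h⟩ := h
  exact ⟨M₄⁻¹, inv_pos.2 hM, h.mono fun G H hG hH => leiRenThreshold_ge hM hG hH⟩


/-! ## B′. The local axis-modulus ladder (frame of `seregin2022_logSwirl_regularAtOrigin`) -/

/-- `LocalSwirlModulusCriterion m`: an axisymmetric suitable weak solution in the unit parabolic
cylinder (frame of the tree fact `seregin2022_logSwirl_regularAtOrigin`, verbatim) whose swirl obeys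
`|Γ(t,x)| ≤ m(r)` on the whole cylinder off the axis (`0 < r = cylRadius x < 1`) is regular at the
origin.  Printed rung: `m(r) = C₁ / ln³(e/r)`, any `C₁` (Seregin 2022: `seregin_iff`).  The rung
`m(r) = |ln r|^{-3/2}` (a LOCAL Wei criterion, `LocalWeiModulus`) is not in print: Lei–Ren 2024
localise Wei's argument but conclude the threshold form (Thm. 3), and the modulus form does not
follow from it by zooming (the local energies `G, H` of the zoomed solution are not bounded). This
is the rung that would halve the a-priori modulus the registered line of crux
`AxisymmetricKatoGlobal` (stmt-…-15453, stub `stub_swirlAxisModulus`: `|Γ| ≤ C/|ln r|³`) must supply. -/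
def LocalSwirlModulusCriterion (m : ℝ → ℝ) : Prop :=
  ∀ (v : ℝ → ℝ³ → ℝ³) (q : ℝ → ℝ³ → ℝ),
    IsSuitableWeakSolutionOn (SereginSverak2009.parCylOpens 0 1) 1 0 v q →
    (∃ C : ℝ≥0, ∀ᵐ t ∂(volume.restrict (Ioo (-1 : ℝ) 0)),
        ∫⁻ x in SereginSverak2009.spaceCyl 0 1, ‖v t x‖ₑ ^ 2 ≤ C) →
    (∃ G : ℝ → ℝ³ → ℝ³ →L[ℝ] ℝ³,
        HasWeakSpatialGradientOn (SereginSverak2009.parCylOpens 0 1) v G ∧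
        ∫⁻ z in SereginSverak2009.parCyl 0 1, ENNReal.ofReal (frobeniusNormSq (G z.1 z.2)) < ∞) →
    (∫⁻ z in SereginSverak2009.parCyl 0 1, ‖q z.1 z.2‖ₑ ^ (3 / 2 : ℝ) < ∞) →
    (∀ t ∈ Ioo (-1 : ℝ) 0, IsAxisymmetric (v t)) →
    (∀ t ∈ Ioo (-1 : ℝ) 0, IsAxisymmetricScalar (q t)) →
    (∀ t ∈ Ioo (-1 : ℝ) 0, ∀ x ∈ SereginSverak2009.spaceCyl 0 1, 0 < cylRadius x →
        |swirl (v t) x| ≤ m (cylRadius x)) →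
    SereginSverak2009.IsRegularAtOrigin v

/-- **Seregin 2022 IS the family of rungs `m(r) = C₁/ln³(e/r)`** (pure logic on the tree fact). -/
theorem seregin_iff :
    seregin2022_logSwirl_regularAtOrigin ↔
      ∀ C₁ : ℝ, LocalSwirlModulusCriterion (fun r => C₁ / Real.log (Real.exp 1 / r) ^ 3) := by
  constructor
  · intro h C₁ v q hsw hL2 hG hq hax haxq hΓ
    exact h v q hsw hL2 hG hq hax haxq ⟨C₁, hΓ⟩
  · intro h v q hsw hL2 hG hq hax haxq hΓ
    obtain ⟨C₁, hΓ⟩ := hΓ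
    exact h C₁ v q hsw hL2 hG hq hax haxq hΓ

/-- Monotonicity of the local modulus ladder (comparison on the whole radius range `(0,1)`, since
the local hypothesis is imposed on the whole cylinder). -/
theorem LocalSwirlModulusCriterion.mono {m₁ m₂ : ℝ → ℝ} (h : LocalSwirlModulusCriterion m₂)
    (hle : ∀ r : ℝ, 0 < r → r < 1 → m₁ r ≤ m₂ r) : LocalSwirlModulusCriterion m₁ := by
  intro v q hsw hL2 hG hq hax haxq hΓ
  refine h v q hsw hL2 hG hq hax haxq fun t ht x hx hr => (hΓ t ht x hx hr).trans (hle _ hr ?_)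
  exact (SereginSverak2009.mem_spaceCyl.1 hx).1.trans_eq' (by simp)

/-- **Local Wei criterion** (exponent `3/2`, constant `1`, local suitable weak frame). OPEN in print
(the global version is the tree fact `Wei2016_logModulus_regularity`). -/
@[conjecture] def LocalWeiModulus : Prop :=
  LocalSwirlModulusCriterion (fun r => |Real.log r| ^ (-(3 / 2 : ℝ)))


/-! ## C. The Type-II-excess ladder (growth of the scaled dissipation, local suitable weak frame) -/

/-- `DissipationGrowthCriterion ω`: in the frame of the tree fact
`Seregin2020_axisymmetricSingularPoint_typeII` (axisymmetric suitable weak solution in the unit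
parabolic cylinder, `ν = 1`), a one-point bound on the GROWTH of the scaled dissipation
`E(r) = r⁻¹ ∫_{Q_r(0)} |∇u|²` (accepted `cknE`), namely `E(r) ≤ K ω(r)` for `0 < r ≤ r₀`, rules out a
(backward) singularity at the space-time origin.  `ω ≡ 1` is one-point Type I (Seregin 2020:
axisymmetric singular points are Type II); `ω(r) = (ln|ln r|)^μ` is Lei–Ren 2024 Thm. 4 ("improved
CKN", via Chen–Tsai–Zhang 2022); `ω(r) = |ln r|^μ` is Lei–Ren's QUESTION (p. 6); `ω(r) = r^{-κ}`,
`0 < κ < 1`, excludes Type II blow-up of excess order `κ`; `ω(r) = r⁻¹` is no hypothesis at all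
(`powerOne_iff_localAxisymRegularity`): the top of this ladder is local axisymmetric regularity. -/
def DissipationGrowthCriterion (ω : ℝ → ℝ) : Prop :=
  ∀ (u : ℝ → ℝ³ → ℝ³) (p : ℝ → ℝ³ → ℝ) (G : ℝ → ℝ³ → ℝ³ →L[ℝ] ℝ³),
    IsSuitableWeakSolutionOn (SereginSverak2009.parCylOpens 0 1) 1 0 u p →
    (∃ C : ℝ≥0, ∀ᵐ t ∂(volume.restrict (Ioo (-1 : ℝ) 0)),
      ∫⁻ x in SereginSverak2009.spaceCyl 0 1, ‖u t x‖ₑ ^ 2 ≤ C) →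
    HasWeakSpatialGradientOn (SereginSverak2009.parCylOpens 0 1) u G →
    (∫⁻ z in SereginSverak2009.parCyl 0 1, ENNReal.ofReal (frobeniusNormSq (G z.1 z.2)) < ∞) →
    (∫⁻ z in SereginSverak2009.parCyl 0 1, ‖p z.1 z.2‖ₑ ^ (3 / 2 : ℝ) < ∞) →
    (∀ t ∈ Ioo (-1 : ℝ) 0, IsAxisymmetric (u t)) →
    (∀ t ∈ Ioo (-1 : ℝ) 0, IsAxisymmetricScalar (p t)) →
    (∃ K r₀ : ℝ, 0 ≤ K ∧ 0 < r₀ ∧ ∀ r : ℝ, 0 < r → r ≤ r₀ →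
        cknE r (0 : ℝ × ℝ³) G ≤ ENNReal.ofReal (K * ω r)) →
    ¬ IsBackwardSingularPoint u 0

/-- **Local axisymmetric regularity** (no growth hypothesis): the local form, in this frame, of the
hard core "axisymmetric with swirl is regular". -/
@[conjecture] def LocalAxisymRegularity : Prop :=
  ∀ (u : ℝ → ℝ³ → ℝ³) (p : ℝ → ℝ³ → ℝ) (G : ℝ → ℝ³ → ℝ³ →L[ℝ] ℝ³),
    IsSuitableWeakSolutionOn (SereginSverak2009.parCylOpens 0 1) 1 0 u p →
    (∃ C : ℝ≥0, ∀ᵐ t ∂(volume.restrict (Ioo (-1 : ℝ) 0)),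
      ∫⁻ x in SereginSverak2009.spaceCyl 0 1, ‖u t x‖ₑ ^ 2 ≤ C) →
    HasWeakSpatialGradientOn (SereginSverak2009.parCylOpens 0 1) u G →
    (∫⁻ z in SereginSverak2009.parCyl 0 1, ENNReal.ofReal (frobeniusNormSq (G z.1 z.2)) < ∞) →
    (∫⁻ z in SereginSverak2009.parCyl 0 1, ‖p z.1 z.2‖ₑ ^ (3 / 2 : ℝ) < ∞) →
    (∀ t ∈ Ioo (-1 : ℝ) 0, IsAxisymmetric (u t)) →
    (∀ t ∈ Ioo (-1 : ℝ) 0, IsAxisymmetricScalar (p t)) →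
    ¬ IsBackwardSingularPoint u 0

/-- **Lei–Ren 2024, Thm. 4 ("improved CKN criterion at one scale … along with careful analysis"),
in this frame** — a TYPING REQUEST (printed theorem, arXiv:2210.01783 p. 6: `limsup_{r→0}
r⁻¹(ln|ln r|)^{-μ} ∫_{Q(r)}|∇v|² < ∞ ⇒ (0,0) regular`, `μ > 0` absolute). -/
def LeiRen2024ImprovedCKN : Prop :=
  ∃ μ : ℝ, 0 < μ ∧ DissipationGrowthCriterion (fun r => Real.log |Real.log r| ^ μ)

/-- **Lei–Ren's question (p. 6)**: the same with a full logarithm, `E(r) ≤ K |ln r|^μ`. OPEN. -/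
@[conjecture] def LogExcessCriterion (μ : ℝ) : Prop :=
  DissipationGrowthCriterion (fun r => |Real.log r| ^ μ)

/-- **Power excess**: `E(r) ≤ K r^{-κ}` rules out the singularity — "no Type II blow-up of excess
order `κ`".  OPEN for every `κ ∈ (0,1)`; `κ = 1` is `LocalAxisymRegularity`. -/
@[conjecture] def PowerExcessCriterion (κ : ℝ) : Prop :=
  DissipationGrowthCriterion (fun r => r ^ (-κ))

/-- Monotonicity of the excess ladder in the growth function (near `r = 0`). -/
theorem DissipationGrowthCriterion.mono {ω₁ ω₂ : ℝ → ℝ} (h : DissipationGrowthCriterion ω₂)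
    (hle : ∃ δ₁ : ℝ, 0 < δ₁ ∧ ∀ r : ℝ, 0 < r → r ≤ δ₁ → ω₁ r ≤ ω₂ r) :
    DissipationGrowthCriterion ω₁ := by
  obtain ⟨δ₁, hδ₁, hle⟩ := hle
  intro u p G hsw hA hG hE hp hax hpax hgrowth
  obtain ⟨K, r₀, hK, hr₀, hb⟩ := hgrowth
  refine h u p G hsw hA hG hE hp hax hpax ⟨K, min r₀ δ₁, hK, lt_min hr₀ hδ₁, fun r hr hrle => ?_⟩
  exact (hb r hr (hrle.trans (min_le_left _ _))).trans
    (ENNReal.ofReal_le_ofReal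
      (mul_le_mul_of_nonneg_left (hle r hr (hrle.trans (min_le_right _ _))) hK))

/-- **The bottom rung is a theorem of the tree's fact layer**: Seregin 2020 (axisymmetric singular
points are Type II) gives the criterion with `ω ≡ 1` (one-point Type I in `E` ⇒ regular). -/
theorem dissipationGrowth_const_of_seregin2020 (h : Seregin2020_axisymmetricSingularPoint_typeII) :
    DissipationGrowthCriterion (fun _ => 1) := by
  intro u p G hsw hA hG hE hp hax hpax hgrowth hsing
  obtain ⟨K, r₀, _, hr₀, hb⟩ := hgrowth
  have htop := (Seregin2020.blowupIndex_eq_top_iff.1 (h u p G hsw hA hG hE hp hax hpax hsing)).1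
  have hle : limsup (fun r => cknE r (0 : ℝ × ℝ³) G) (𝓝[>] 0) ≤ ENNReal.ofReal (K * 1) := by
    refine Filter.limsup_le_of_le (by isBoundedDefault) ?_
    filter_upwards [Ioc_mem_nhdsGT hr₀] with r hr
    exact hb r hr.1 hr.2
  rw [htop, top_le_iff] at hle
  exact ENNReal.ofReal_ne_top hle

/-- Local axisymmetric regularity gives every rung. -/
theorem DissipationGrowthCriterion.of_localAxisymRegularity (h : LocalAxisymRegularity)
    (ω : ℝ → ℝ) : DissipationGrowthCriterion ω :=
  fun u p G hsw hA hG hE hp hax hpax _ => h u p G hsw hA hG hE hp hax hpax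

/-- `E(r) ≤ (∫_Q |∇u|²) · r⁻¹` for `0 < r ≤ 1`: the growth `ω(r) = r⁻¹` is automatic. -/
theorem cknE_le_of_le_one {G : ℝ → ℝ³ → ℝ³ →L[ℝ] ℝ³}
    (hE : ∫⁻ z in SereginSverak2009.parCyl 0 1, ENNReal.ofReal (frobeniusNormSq (G z.1 z.2)) < ∞)
    {r : ℝ} (hr : 0 < r) (hr1 : r ≤ 1) :
    cknE r (0 : ℝ × ℝ³) G ≤
      ENNReal.ofReal
        ((∫⁻ z in SereginSverak2009.parCyl 0 1, ENNReal.ofReal (frobeniusNormSq (G z.1 z.2))).toReal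
          * r ^ (-(1 : ℝ))) := by
  have hsub : parabolicCylinder r (0 : ℝ × ℝ³) ⊆ SereginSverak2009.parCyl 0 1 :=
    (parabolicCylinder_subset_parCyl (0 : ℝ × ℝ³) r).trans
      (SereginSverak2009.parCyl_mono (0 : ℝ × ℝ³) hr.le hr1)
  unfold cknE
  calc (ENNReal.ofReal r)⁻¹ *
        ∫⁻ q in parabolicCylinder r (0 : ℝ × ℝ³), ENNReal.ofReal (frobeniusNormSq (G q.1 q.2))
      ≤ (ENNReal.ofReal r)⁻¹ *
        ∫⁻ q in SereginSverak2009.parCyl 0 1, ENNReal.ofReal (frobeniusNormSq (G q.1 q.2)) :=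
        mul_le_mul_right (lintegral_mono_set hsub) _
    _ = ENNReal.ofReal
        ((∫⁻ z in SereginSverak2009.parCyl 0 1, ENNReal.ofReal (frobeniusNormSq (G z.1 z.2))).toReal
          * r ^ (-(1 : ℝ))) := by
        rw [Real.rpow_neg_one, mul_comm (_ : ℝ) r⁻¹, ENNReal.ofReal_mul (inv_nonneg.2 hr.le),
          ENNReal.ofReal_inv_of_pos hr, ENNReal.ofReal_toReal hE.ne]

/-- **The top of the excess ladder is the (local) hard core**: `ω(r) = r⁻¹` is no hypothesis. -/
theorem powerOne_iff_localAxisymRegularity : PowerExcessCriterion 1 ↔ LocalAxisymRegularity := by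
  constructor
  · intro h u p G hsw hA hG hE hp hax hpax
    exact h u p G hsw hA hG hE hp hax hpax
      ⟨(∫⁻ z in SereginSverak2009.parCyl 0 1, ENNReal.ofReal (frobeniusNormSq (G z.1 z.2))).toReal,
        1, ENNReal.toReal_nonneg, one_pos, fun r hr hr1 => cknE_le_of_le_one hE hr hr1⟩
  · intro h
    exact DissipationGrowthCriterion.of_localAxisymRegularity h _

/-- `|ln r| ≤ r⁻¹` on `(0,1]`. -/
theorem abs_log_le_inv {r : ℝ} (hr : 0 < r) (hr1 : r ≤ 1) : |Real.log r| ≤ r⁻¹ := by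
  have hlog : Real.log r ≤ 0 := Real.log_nonpos hr.le hr1
  rw [abs_of_nonpos hlog, ← Real.log_inv]
  have := Real.log_le_sub_one_of_pos (inv_pos.2 hr)
  linarith

/-- Power rungs dominate log rungs: `PowerExcessCriterion κ → LogExcessCriterion μ` for
`0 ≤ μ ≤ κ` (since `|ln r|^μ ≤ r^{-μ} ≤ r^{-κ}` on `(0,1]`). -/
theorem logExcess_of_powerExcess {κ μ : ℝ} (h : PowerExcessCriterion κ) (hμ : 0 ≤ μ) (hμκ : μ ≤ κ) :
    LogExcessCriterion μ := by
  refine DissipationGrowthCriterion.mono h ⟨1, one_pos, fun r hr hr1 => ?_⟩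
  calc |Real.log r| ^ μ ≤ (r⁻¹) ^ μ :=
        Real.rpow_le_rpow (abs_nonneg _) (abs_log_le_inv hr hr1) hμ
    _ = r ^ (-μ) := by rw [Real.inv_rpow hr.le, ← Real.rpow_neg hr.le]
    _ ≤ r ^ (-κ) := Real.rpow_le_rpow_of_exponent_ge hr hr1 (neg_le_neg hμκ)

/-- Log rungs dominate the iterated-log rungs of Lei–Ren's Thm. 4 (same exponent `μ ≥ 0`):
`(ln|ln r|)^μ ≤ |ln r|^μ` once `|ln r| ≥ 1`. -/
theorem loglog_of_logExcess {μ : ℝ} (h : LogExcessCriterion μ) (hμ : 0 ≤ μ) :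
    DissipationGrowthCriterion (fun r => Real.log |Real.log r| ^ μ) := by
  refine DissipationGrowthCriterion.mono h ⟨Real.exp (-1), Real.exp_pos _, fun r hr hrδ => ?_⟩
  have hlog : Real.log r ≤ -1 := by
    have := Real.log_le_log hr hrδ
    rwa [Real.log_exp] at this
  have h1 : 1 ≤ |Real.log r| := by
    have : (1 : ℝ) ≤ -Real.log r := by linarith
    exact this.trans (neg_le_abs _)
  have hll : 0 ≤ Real.log |Real.log r| := Real.log_nonneg h1
  exact Real.rpow_le_rpow hll (Real.log_le_self (by linarith)) hμ

/-- The iterated-log rungs (and a fortiori all higher rungs) dominate the Type I rung: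
`1 ≤ (ln|ln r|)^μ` once `|ln r| ≥ e`. -/
theorem const_of_loglog {μ : ℝ} (h : DissipationGrowthCriterion (fun r => Real.log |Real.log r| ^ μ))
    (hμ : 0 ≤ μ) : DissipationGrowthCriterion (fun _ => 1) := by
  refine DissipationGrowthCriterion.mono h
    ⟨Real.exp (-Real.exp 1), Real.exp_pos _, fun r hr hrδ => ?_⟩
  have hlog : Real.log r ≤ -Real.exp 1 := by
    have := Real.log_le_log hr hrδ
    rwa [Real.log_exp] at this
  have h1 : Real.exp 1 ≤ |Real.log r| := by
    have : Real.exp 1 ≤ -Real.log r := by linarith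
    exact this.trans (neg_le_abs _)
  have hll : 1 ≤ Real.log |Real.log r| := by
    rw [← Real.log_exp 1]
    exact Real.log_le_log (Real.exp_pos 1) h1
  exact Real.one_le_rpow hll hμ

/-- Summary of the excess ladder above the printed rungs:
`LocalAxisymRegularity ⇒ PowerExcess κ ⇒ LogExcess μ ⇒ (Lei–Ren's ln ln form) ⇒ Type I form`. -/
theorem excessLadder_summary {κ μ : ℝ} (hμ : 0 < μ) (hμκ : μ ≤ κ) :
    (LocalAxisymRegularity → PowerExcessCriterion κ) ∧
    (PowerExcessCriterion κ → LogExcessCriterion μ) ∧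
    (LogExcessCriterion μ → LeiRen2024ImprovedCKN) ∧
    (LeiRen2024ImprovedCKN → DissipationGrowthCriterion (fun _ => 1)) :=
  ⟨fun h => DissipationGrowthCriterion.of_localAxisymRegularity h _,
   fun h => logExcess_of_powerExcess h hμ.le hμκ,
   fun h => ⟨μ, hμ, loglog_of_logExcess h hμ.le⟩,
   fun ⟨_, hμ', h⟩ => const_of_loglog h hμ'.le⟩

end

end Summit.NavierStokesRegularity.NavierStokesRegularity.Theorems.SwirlThresholdLadderLocal
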